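import Literature.AlgebraicGeometry.HodgeTheory.RealSl2BlocksTimesCMHodgeClasses
import Literature.AlgebraicGeometry.HodgeTheory.HodgeClassesProductSpanCriterion
import Literature.AlgebraicGeometry.HodgeTheory.HodgeGroupProductCMFactorDiscOne
import Literature.AlgebraicGeometry.HodgeTheory.MixedEllipticCurvesProductsHodgeClasses
import Literature.AlgebraicGeometry.HodgeTheory.MixedPowersRetract
import Literature.AlgebraicGeometry.HodgeTheory.RealSl2BlocksFiniteProducts
import HarnessLib

/-!
# `HodgeClassesProductSpan B Z` UNCONDITIONALLY for `B` with slots over an abelian variety with real `𝔰𝔩₂`-block data and `Z` with slots over a CM abelian variety — the «RM × CM» slice of Lombardo 2016 Lemma 3.4 / Moonen–Zarhin 1999 (3.1), proved; hence HC_CM ⟹ HC(`A^{N+1} × C^{N+1}`) with NO Lombardo binder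

Family `hodge`, layer `Literature/AlgebraicGeometry/HodgeTheory`. Research context: cell `pub-hodge-ring2`
(HONEST FRAMING: research route conditional on HC_CM; not a corollary; Q11.4-sentence-2 already refuted in
dim ≥ 3), Literature lane, programme R4 («RM × CM»), final assembly. Theorems only, no named fact; no step
towards a summit statement. The product-span statements are UNCONDITIONAL; the Hodge-conjecture statements for
`B × Z` take HC(`Z`) (resp. Milne's per-variety HC_CM hypothesis `CMHodgeHypothesisAt`) as an explicit
hypothesis and NOTHING ELSE — in particular the named fact `Lombardo2016_hodgeClassesProductSpan` (the binder
`hL` of `hodgeConjectureFor_prod_of_cmHodgeHypothesis`) is not used: for this class of `A` it is now a theorem.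

PRINTED RESULT. Lombardo 2016, Lemma 3.4 (p. 1229): «Suppose `B` is of CM type and `A_K̄` has no simple factor
of type IV. Then `H(A × B) ≅ H(A) × H(B)`»; Moonen–Zarhin 1999 §3 (3.1): if `Hg(X₁ × X₂) = Hg(X₁) × Hg(X₂)` then
the Hodge ring of `X₁^m × X₂^n` is generated by the classes coming from `B(X₁)` and `B(X₂)`. Here `A` ranges over
the carriers of real `𝔰𝔩₂`-block data (`HasRealSl2Blocks`: `End⁰(A)` commutative with real characters cutting
`H¹(A) ⊗ ℂ` into two-dimensional Hodge-adapted blocks with rational crossed classes — Hazama 1983 §3, Ribet 1983;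
e.g. `End⁰(A)` a totally real field of degree `dim A`), a sub-class of «no factor of type IV».

RESULTS.
* `HasRealSl2Blocks.hodgeClassesProductSpan_of_avSlots` — **`HodgeClassesProductSpan B Z`** for `B` with `n`
  slots over `A` (`HasRealSl2Blocks A`) and `Z` with `n` slots over `C` of CM type: every rational `(p,p)`-class
  on `B × Z` is a `ℂ`-combination of `pr_B^* a ⌣ pr_Z^* b` with `a`, `b` RATIONAL HODGE classes
  (`RealSl2BlocksTimesCMHodgeClasses` + the criterion `mem_span_hodgeProductClasses_of_mem_span_typed`).
* `HasRealSl2Blocks.hodgeClassesProductSpan_powSucc_powSucc` — the case `B = A^{N+1}`, `Z = C^{N+1}`.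
* `HasRealSl2Blocks.hodgeConjectureFor_prod_of_avSlots` — HC(`Z`) ⟹ HC(`B × Z`) (HC(`B`) is the tree's
  unconditional `HasRealSl2Blocks.isDivisorGenerated_of_avSlots`).
* `HasRealSl2Blocks.hodgeConjectureFor_powSucc_prod_powSucc_of_cmHodgeHypothesis` — Milne's HC_CM hypothesis
  ⟹ HC(`A^{N+1} × C^{N+1}`), no other input; primed version: all exponents `A^{M+1} × C^{N+1}` (retract
  `powLift_clamp_comp_powLift_castLE` into equal exponents); `HasRealSl2Blocks.hodgeClassesProductSpan` /
  `.hodgeConjectureFor_prod_of_cmHodgeHypothesis` — the case `A × C` itself; the two displayed sub-classes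
  `…_of_isTotallyReal_of_cmType_…` (`End⁰(A)` totally real of degree `dim A`) and
  `…_of_finrank_endAlgebra_eq_one_of_cmType_…` (non-CM elliptic curves); and
  `….hodgeConjectureFor_of_isIsogenous_powSucc_prod_powSucc_of_cmHodgeHypothesis` (everything isogenous to
  some `A^{M+1} × C^{N+1}`, van Geemen's Lemma 3.7); `….hodgeConjectureFor_powSucc_prod_of_cmHodgeHypothesis`
  (`A^{M+1} × C`, `C` any CM abelian variety); `hodgeConjectureFor_finProd_powSucc_prod_of_hasRealSl2Blocks_…` /
  `hodgeConjectureFor_powSucc_prod_powSucc_prod_of_hasRealSl2Blocks_…` (finite pairwise orthogonal families of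
  carriers with arbitrary exponents, times any CM abelian variety).

## References

* [Lombardo2016] D. Lombardo, Ann. Inst. Fourier 66 (2016), Lemma 3.4 (p. 1229). [cite: Lombardo2016, Lemma 3.4 (p. 1229)]
* [MoonenZarhin1999LowDim] B. Moonen, Yu. Zarhin, Math. Ann. 315 (1999), §3 (3.1). [cite: MoonenZarhin1999LowDim, §3 (3.1)]
* [Hazama1983] F. Hazama, Tôhoku Math. J. 35 (1983), Thm. (1.1), §3 pp. 305–306. [cite: Hazama1983, §3 (pp. 305–306)]
* [Ribet1983] K. A. Ribet, Amer. J. Math. 105 (1983), Thm. 0–1. [cite: Ribet1983, Thm. 0–1]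
* [Milne1999] J. S. Milne, Lefschetz motives and the Tate conjecture, Compositio 117 (1999), §2 p. 54, §7 p. 72. [cite: Milne1999, §7 p. 72]
* [VoisinHodgeII2003] C. Voisin, *Hodge Theory II*, proof of Prop. 9.20. [cite: VoisinHodgeII2003, proof of Prop. 9.20 (first display)]
-/

noncomputable section

open scoped TensorProduct
open CategoryTheory Module MonoidalCategory CartesianMonoidalCategory NumberField

namespace Literature.AlgebraicGeometry.HodgeTheory

open Literature.AlgebraicTopology.SingularHomology
open Literature.AlgebraicGeometry.Motives (IsSmoothProjective AbelianVariety bettiCohomology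
  ofRatClassBaseChange)
open Literature.Barriers.HodgeConjecture
open Literature.AlgebraicGeometry.Milne1999 (powLift powProj pow_hom_ext powLift_powProj)
open Literature.AlgebraicGeometry.ComplexMultiplication (EndField)

section ProductSpan

variable {A B C Z : AbelianVariety ℂ} {n : ℕ} {gB : Fin n → (B ⟶ A)} {gC : Fin n → (Z ⟶ C)}

/-- **`HodgeClassesProductSpan B Z` — the «RM × CM» slice of Lombardo's Lemma 3.4, PROVED.** Let `A` carry real
`𝔰𝔩₂`-block data, `C` be of CM type, `B` have `n` slots over `A` and `Z` have `n` slots over `C`. Then every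
rational class of Hodge type `(p,p)` on `B × Z` is a `ℂ`-combination of exterior products `pr_B^* a ⌣ pr_Z^* b` of
RATIONAL HODGE classes `a` of `B` and `b` of `Z`. [cite: Lombardo2016, Lemma 3.4 (p. 1229)]
[cite: MoonenZarhin1999LowDim, §3 (3.1)] [cite: Hazama1983, Thm. (1.1) and §3 (pp. 305–306)] -/
theorem HasRealSl2Blocks.hodgeClassesProductSpan_of_avSlots (hA : HasRealSl2Blocks A)
    (hC : Milne1999.IsOfCMType C) (hgB : AVSlots A B gB) (hgC : AVSlots C Z gC) :
    HodgeClassesProductSpan B Z := by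
  classical
  intro p c hcQ hc
  have hB : IsSmoothProjective B.dim B.X := Motives.AbelianVariety.isSmoothProjective_holds
  have hZ : IsSmoothProjective Z.dim Z.X := Motives.AbelianVariety.isSmoothProjective_holds
  have hXC : IsSmoothProjective C.dim C.X := Motives.AbelianVariety.isSmoothProjective_holds
  have hHD : exists_isReal_hodgeModel := exists_isReal_hodgeModel_holds
  have hI : hodgePQ_independent_of_hodgeModel := hodgePQ_independent_of_hodgeModel_holds
  obtain ⟨h, cC, hcC0, hcC1, hspan⟩ := hA.exists_cmLetters_hodgeClasses_prod_mem_span hC hgB hgC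
  have hc' : IsOfHodgeType (B.prod Z).dim (B.prod Z).X (2 * p) p p c := by
    rw [Motives.AbelianVariety.dim_prod]; exact hc
  have hmem := hspan p c hcQ hc'
  -- the letters of `Z` have types `(1,0)` / `(0,1)`
  set y : (Fin n × Fin h) × Fin 2 → complexBetti Z.X 1 := fun jr =>
    complexBetti.map (gC jr.1.1).hom.hom.hom 1 (ofRatClassBaseChange (Motives.ComplexPoints C.X) 1 (cC (jr.1.2, jr.2)))
    with hy
  have hy0 : ∀ jr : (Fin n × Fin h) × Fin 2, jr.2 = 0 → IsOfHodgeType Z.dim Z.X 1 1 0 (y jr) := by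
    rintro ⟨⟨j, i⟩, κ⟩ hκ
    change κ = 0 at hκ
    subst hκ
    exact ((BettiUniverse.mem_hodge_piece_iff hHD hI hXC (k := 1) (p := 1) (q := 0) rfl (cC (i, 0))).1
      (hcC0 i)).map_of_isSmoothProjective hZ hXC _
  have hy1 : ∀ jr : (Fin n × Fin h) × Fin 2, jr.2 = 1 → IsOfHodgeType Z.dim Z.X 1 0 1 (y jr) := by
    rintro ⟨⟨j, i⟩, κ⟩ hκ
    change κ = 1 at hκ
    subst hκ
    exact ((BettiUniverse.mem_hodge_piece_iff hHD hI hXC (k := 1) (p := 0) (q := 1) rfl (cC (i, 1))).1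
      (hcC1 i)).map_of_isSmoothProjective hZ hXC _
  -- monomials in the letters of `Z` have a pure type
  have hmono : ∀ (r : ℕ) (w : Fin r → (Fin n × Fin h) × Fin 2), ∃ r₀ r₁, r₀ + r₁ = r ∧
      IsOfHodgeType Z.dim Z.X r r₀ r₁ (cupPowOne ℂ (Motives.ComplexPoints Z.X) r (fun t => y (w t))) := by
    intro r w
    rcases Nat.eq_zero_or_pos r with rfl | hr
    · exact ⟨0, 0, rfl, isOfHodgeType_zero_zero_of_degree_zero hZ _⟩
    · refine ⟨∑ t, (if (w t).2 = 0 then 1 else 0), ∑ t, (if (w t).2 = 0 then 0 else 1), ?_,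
        isOfHodgeType_cupPowOne hZ hr (fun t => y (w t)) _ _ fun t => ?_⟩
      · rw [← Finset.sum_add_distrib]
        have h2 : ∀ t : Fin r, ((if (w t).2 = 0 then 1 else 0) + (if (w t).2 = 0 then 0 else 1) : ℕ) = 1 :=
          fun t => by split_ifs <;> rfl
        simp only [h2, Finset.sum_const, Finset.card_univ, Fintype.card_fin, smul_eq_mul, mul_one]
      · by_cases h0 : (w t).2 = 0
        · rw [if_pos h0, if_pos h0]; exact hy0 _ h0
        · have h1 : (w t).2 = 1 := by
            have h01 : ∀ x : Fin 2, x ≠ 0 → x = 1 := by decide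
            exact h01 _ h0
          rw [if_neg h0, if_neg h0]; exact hy1 _ h1
  -- feed the criterion
  refine mem_span_hodgeProductClasses_of_mem_span_typed B Z hcQ hc (Submodule.span_mono ?_ hmem)
  rintro z ⟨p', r, hpr, dB, w, hdB, rfl⟩
  obtain ⟨r₀, r₁, hr, htyp⟩ := hmono r w
  refine ⟨2 * p', r, hpr, dB, _, Submodule.span_mono ?_ hdB, ⟨r₀, r₁, hr, htyp⟩, rfl⟩
  intro d hd
  exact ⟨isRationalClass_of_mem_divisorMonomials hd, p', rfl, isOfHodgeType_of_mem_divisorMonomials hB hd⟩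

/-- **`HodgeClassesProductSpan (A^{N+1}) (C^{N+1})`** for `A` with real `𝔰𝔩₂`-block data and `C` of CM type.
[cite: Lombardo2016, Lemma 3.4 (p. 1229)] [cite: MoonenZarhin1999LowDim, §3 (3.1)] -/
theorem HasRealSl2Blocks.hodgeClassesProductSpan_powSucc_powSucc (hA : HasRealSl2Blocks A)
    (hC : Milne1999.IsOfCMType C) (N : ℕ) :
    HodgeClassesProductSpan (A.powSucc N) (C.powSucc N) :=
  hA.hodgeClassesProductSpan_of_avSlots hC (AVSlots.powSucc A N) (AVSlots.powSucc C N)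

/-! ### Consequences for the Hodge conjecture (the `Z`-side hypothesis explicit, no other binder) -/

/-- **HC(`Z`) ⟹ HC(`B × Z`)** for `B` with slots over `A` with real `𝔰𝔩₂`-block data and `Z` with as many
slots over `C` of CM type: HC(`B`) is unconditional (`B(B) = D(B)`, the tree's
`HasRealSl2Blocks.isDivisorGenerated_of_avSlots` and `hodgeConjectureFor_of_isDivisorGenerated`), the product
span is `hodgeClassesProductSpan_of_avSlots`, and exterior products of algebraic classes are algebraic
(`hodgeConjectureFor_prod_of_productSpan`). [cite: Lombardo2016, Lemma 3.4 (p. 1229)]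
[cite: VoisinHodgeII2003, proof of Prop. 9.20 (first display)] -/
theorem HasRealSl2Blocks.hodgeConjectureFor_prod_of_avSlots (hA : HasRealSl2Blocks A)
    (hC : Milne1999.IsOfCMType C) (hgB : AVSlots A B gB) (hgC : AVSlots C Z gC)
    (hZ : HodgeConjectureFor Z.dim Z.X) : HodgeConjectureFor (B.prod Z).dim (B.prod Z).X :=
  hodgeConjectureFor_prod_of_productSpan B Z (hA.hodgeClassesProductSpan_of_avSlots hC hgB hgC)
    (hodgeConjectureFor_of_isDivisorGenerated B (hA.isDivisorGenerated_of_avSlots hgB)) hZ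

/-- **Milne's per-variety HC_CM hypothesis ⟹ HC(`A^{N+1} × C^{N+1}`)** for `A` with real `𝔰𝔩₂`-block data and
`C` of CM type — the product-lane row with the Lombardo binder REMOVED (HONEST FRAMING: research route
conditional on HC_CM; not a corollary; Q11.4-sentence-2 already refuted in dim ≥ 3). The hypothesis is used
once, at the CM abelian variety `C^{N+1}` (`isOfCMType_powSucc`). [cite: Lombardo2016, Lemma 3.4 (p. 1229)]
[cite: Milne1999, §7 p. 72] -/
theorem HasRealSl2Blocks.hodgeConjectureFor_powSucc_prod_powSucc_of_cmHodgeHypothesis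
    (hCM : ∀ Y : AbelianVariety ℂ, Milne1999.CMHodgeHypothesisAt Y) (hA : HasRealSl2Blocks A)
    (hC : Milne1999.IsOfCMType C) (N : ℕ) :
    HodgeConjectureFor ((A.powSucc N).prod (C.powSucc N)).dim ((A.powSucc N).prod (C.powSucc N)).X :=
  hA.hodgeConjectureFor_prod_of_avSlots hC (AVSlots.powSucc A N) (AVSlots.powSucc C N)
    (hCM (C.powSucc N) Motives.AbelianVariety.isSmoothProjective_holds (isOfCMType_powSucc hC N))

/-- **`HodgeClassesProductSpan A C` itself** (one slot on each side: `A` with real `𝔰𝔩₂`-block data, `C` of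
CM type) — Lombardo's Lemma 3.4 with Moonen–Zarhin (3.1) for `m = n = 1`, PROVED for this class.
[cite: Lombardo2016, Lemma 3.4 (p. 1229)] [cite: MoonenZarhin1999LowDim, §3 (3.1)] -/
theorem HasRealSl2Blocks.hodgeClassesProductSpan (hA : HasRealSl2Blocks A) (hC : Milne1999.IsOfCMType C) :
    HodgeClassesProductSpan A C :=
  hA.hodgeClassesProductSpan_of_avSlots hC (avSlots_self A) (avSlots_self C)

/-- **Milne's per-variety HC_CM hypothesis ⟹ HC(`A × C`)** for `A` with real `𝔰𝔩₂`-block data and `C` of CM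
type: the tree's `hodgeConjectureFor_prod_of_cmHodgeHypothesis hCM hL A C hA4 hCt hA` with the binders `hL`
(Lombardo's span fact), `hA4` (no type-IV factor) and `hA` (HC for `A`) ALL DISCHARGED on this class (HONEST
FRAMING: research route conditional on HC_CM; not a corollary; Q11.4-sentence-2 already refuted in dim ≥ 3).
[cite: Lombardo2016, Lemma 3.4 (p. 1229)] [cite: Milne1999, §7 p. 72] -/
theorem HasRealSl2Blocks.hodgeConjectureFor_prod_of_cmHodgeHypothesis
    (hCM : ∀ Y : AbelianVariety ℂ, Milne1999.CMHodgeHypothesisAt Y) (hA : HasRealSl2Blocks A)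
    (hC : Milne1999.IsOfCMType C) : HodgeConjectureFor (A.prod C).dim (A.prod C).X :=
  hA.hodgeConjectureFor_prod_of_avSlots hC (avSlots_self A) (avSlots_self C)
    (hCM C Motives.AbelianVariety.isSmoothProjective_holds hC)

/-- **`A^{M+1}` is a retract of `A^{K+1}`** (`M ≤ K`): the truncation `(pr_{min(r,M)})_r` followed by the projection
to the first `M+1` factors is the identity. [cite: MumfordAV1970, §19 (Hom(C, A × B) = Hom(C, A) ⊕ Hom(C, B))] -/
theorem powLift_clamp_comp_powLift_castLE {X : AbelianVariety ℂ} {M K : ℕ} (hMK : M ≤ K) :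
    (powLift K fun r : Fin (K + 1) => powProj X M (⟨min (r : ℕ) M, by omega⟩ : Fin (M + 1))) ≫
      (powLift M fun i : Fin (M + 1) => powProj X K (i.castLE (by omega))) = 𝟙 (X.powSucc M) := by
  refine pow_hom_ext M fun i => ?_
  rw [Category.assoc, powLift_powProj, powLift_powProj, Category.id_comp]
  congr 1
  ext
  simp only [Fin.val_castLE]
  have := i.2
  omega

/-- **Milne's per-variety HC_CM hypothesis ⟹ HC(`A^{M+1} × C^{N+1}`) for ALL `M, N`** (`A` with real `𝔰𝔩₂`-block
data, `C` of CM type): `A^{M+1} × C^{N+1}` is a retract of `A^{K+1} × C^{K+1}`, `K = max(M, N)`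
(`powLift_clamp_comp_powLift_castLE` in both factors), and the Hodge conjecture descends along retracts
(`HodgeConjectureFor.of_comp_eq_nsmul_id`). [cite: Lombardo2016, Lemma 3.4 (p. 1229)]
[cite: vanGeemen1994HodgeAV, §3.6–3.7 Lemma 3.7 (p. 236)] -/
theorem HasRealSl2Blocks.hodgeConjectureFor_powSucc_prod_powSucc_of_cmHodgeHypothesis'
    (hCM : ∀ Y : AbelianVariety ℂ, Milne1999.CMHodgeHypothesisAt Y) (hA : HasRealSl2Blocks A)
    (hC : Milne1999.IsOfCMType C) (M N : ℕ) :
    HodgeConjectureFor ((A.powSucc M).prod (C.powSucc N)).dim ((A.powSucc M).prod (C.powSucc N)).X := by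
  have hM : M ≤ max M N := le_max_left M N
  have hN : N ≤ max M N := le_max_right M N
  refine HodgeConjectureFor.of_comp_eq_nsmul_id
    (Motives.AbelianVariety.prodMap
      (powLift (max M N) fun r : Fin (max M N + 1) => powProj A M (⟨min (r : ℕ) M, by omega⟩ : Fin (M + 1)))
      (powLift (max M N) fun r : Fin (max M N + 1) => powProj C N (⟨min (r : ℕ) N, by omega⟩ : Fin (N + 1))))
    (Motives.AbelianVariety.prodMap (powLift M fun i => powProj A (max M N) (i.castLE (by omega)))
      (powLift N fun j => powProj C (max M N) (j.castLE (by omega))))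
    one_ne_zero ?_ (hA.hodgeConjectureFor_powSucc_prod_powSucc_of_cmHodgeHypothesis hCM hC (max M N))
  rw [one_smul]
  apply Motives.AbelianVariety.prod_hom_ext
  · rw [Category.assoc, Motives.AbelianVariety.prodMap_fst, Motives.AbelianVariety.prodMap_fst_assoc,
      powLift_clamp_comp_powLift_castLE hM, Category.comp_id, Category.id_comp]
  · rw [Category.assoc, Motives.AbelianVariety.prodMap_snd, Motives.AbelianVariety.prodMap_snd_assoc,
      powLift_clamp_comp_powLift_castLE hN, Category.comp_id, Category.id_comp]

/-- **HC_CM ⟹ HC(`A^{M+1} × C`)** for `A` with real `𝔰𝔩₂`-block data and `C` ANY abelian variety of CM type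
(no slot structure on `C` required: `C = C^{0+1}`) — the product-lane rows `A^{N+1} × C` with the binders `hL`,
`hA4`, `hA` discharged on this class. [cite: Lombardo2016, Lemma 3.4 (p. 1229)] [cite: Milne1999, §7 p. 72] -/
theorem HasRealSl2Blocks.hodgeConjectureFor_powSucc_prod_of_cmHodgeHypothesis
    (hCM : ∀ Y : AbelianVariety ℂ, Milne1999.CMHodgeHypothesisAt Y) (hA : HasRealSl2Blocks A)
    (hC : Milne1999.IsOfCMType C) (M : ℕ) :
    HodgeConjectureFor ((A.powSucc M).prod C).dim ((A.powSucc M).prod C).X :=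
  hA.hodgeConjectureFor_powSucc_prod_powSucc_of_cmHodgeHypothesis' hCM hC M 0

/-- **HC_CM ⟹ HC(`X`) for every `X` isogenous to some `A^{M+1} × C^{N+1}`** (`A` with real `𝔰𝔩₂`-block
data, `C` of CM type): van Geemen's Lemma 3.7 (the Hodge conjecture is an isogeny invariant) on top of
`hodgeConjectureFor_powSucc_prod_powSucc_of_cmHodgeHypothesis'`. [cite: Lombardo2016, Lemma 3.4 (p. 1229)]
[cite: vanGeemen1994HodgeAV, §3.6–3.7 Lemma 3.7 (p. 236)] [cite: Milne1999, §7 p. 72] -/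
theorem HasRealSl2Blocks.hodgeConjectureFor_of_isIsogenous_powSucc_prod_powSucc_of_cmHodgeHypothesis
    (hCM : ∀ Y : AbelianVariety ℂ, Milne1999.CMHodgeHypothesisAt Y) (hA : HasRealSl2Blocks A)
    (hC : Milne1999.IsOfCMType C) {X : AbelianVariety ℂ} {M N : ℕ}
    (hX : Motives.AbelianVariety.IsIsogenous X ((A.powSucc M).prod (C.powSucc N))) :
    HodgeConjectureFor X.dim X.X :=
  HodgeConjectureFor.of_isIsogenous hX (hA.hodgeConjectureFor_powSucc_prod_powSucc_of_cmHodgeHypothesis' hCM hC M N)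

/-- **HC_CM ⟹ HC(`A₀^{n₀+1} × ⋯ × A_k^{n_k+1} × C`)** for a finite PAIRWISE ORTHOGONAL family `A₀, …, A_k` of
carriers of real `𝔰𝔩₂`-block data (`Hom(A_i, A_j) = 0` for `i ≠ j`), arbitrary exponents, and `C` any abelian
variety of CM type: the product `A₀ × ⋯ × A_k` is again a carrier (`hasRealSl2Blocks_finProd`), the mixed power
is a retract of a power of it (`exists_retract_finProd_powSucc`), times `𝟙_C` (`prodMap_retract`), and the Hodge
conjecture descends along retracts. [cite: Lombardo2016, Lemma 3.4 (p. 1229)]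
[cite: MoonenZarhin1999LowDim, §3 Thm. (3.2)(1)] [cite: vanGeemen1994HodgeAV, §3.6–3.7 Lemma 3.7 (p. 236)] -/
theorem hodgeConjectureFor_finProd_powSucc_prod_of_hasRealSl2Blocks_of_cmHodgeHypothesis
    (hCM : ∀ Y : AbelianVariety ℂ, Milne1999.CMHodgeHypothesisAt Y) (k : ℕ) (A : Fin (k + 1) → AbelianVariety ℂ)
    (hA : ∀ i, HasRealSl2Blocks (A i)) (horth : ∀ i j, i ≠ j → ∀ f : A i ⟶ A j, f = 0)
    (hC : Milne1999.IsOfCMType C) (m : Fin (k + 1) → ℕ) :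
    HodgeConjectureFor ((AbelianVariety.finProd k (fun i => (A i).powSucc (m i))).prod C).dim
      ((AbelianVariety.finProd k (fun i => (A i).powSucc (m i))).prod C).X := by
  obtain ⟨K, t, h, ht⟩ := exists_retract_finProd_powSucc k A m
  exact HodgeConjectureFor.of_comp_eq_nsmul_id (Motives.AbelianVariety.prodMap t (𝟙 C))
    (Motives.AbelianVariety.prodMap h (𝟙 C)) one_ne_zero (by rw [one_smul]; exact prodMap_retract t h ht)
    ((hasRealSl2Blocks_finProd k A hA horth).hodgeConjectureFor_powSucc_prod_of_cmHodgeHypothesis hCM hC K)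

/-- **HC_CM ⟹ HC(`A₁^{a+1} × A₂^{b+1} × C`)** for two ORTHOGONAL carriers `A₁, A₂` of real `𝔰𝔩₂`-block data
(e.g. two non-isogenous non-CM elliptic curves, or two non-isogenous simple abelian varieties with totally real
`End⁰` of degree `dim`) and `C` any abelian variety of CM type. [cite: Lombardo2016, Lemma 3.4 (p. 1229)]
[cite: MoonenZarhin1999LowDim, §3 Thm. (3.2)(1)] [cite: vanGeemen1994HodgeAV, §3.6–3.7 Lemma 3.7 (p. 236)] -/
theorem hodgeConjectureFor_powSucc_prod_powSucc_prod_of_hasRealSl2Blocks_of_cmHodgeHypothesis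
    (hCM : ∀ Y : AbelianVariety ℂ, Milne1999.CMHodgeHypothesisAt Y) {A₁ A₂ : AbelianVariety ℂ}
    (h₁ : HasRealSl2Blocks A₁) (h₂ : HasRealSl2Blocks A₂) (h₁₂ : ∀ f : A₁ ⟶ A₂, f = 0)
    (h₂₁ : ∀ g : A₂ ⟶ A₁, g = 0) (hC : Milne1999.IsOfCMType C) (a b : ℕ) :
    HodgeConjectureFor (((A₁.powSucc a).prod (A₂.powSucc b)).prod C).dim
      (((A₁.powSucc a).prod (A₂.powSucc b)).prod C).X :=
  HodgeConjectureFor.of_comp_eq_nsmul_id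
    (Motives.AbelianVariety.prodMap (mixedPowersIncl A₁ A₂ a b (max a b)) (𝟙 C))
    (Motives.AbelianVariety.prodMap (mixedPowersProj A₁ A₂ a b (max a b) (le_max_left a b) (le_max_right a b)) (𝟙 C))
    one_ne_zero (by rw [one_smul]; exact prodMap_retract _ _ (mixedPowersIncl_comp_mixedPowersProj a b _ _ _))
    ((h₁.prod h₂ h₁₂ h₂₁).hodgeConjectureFor_powSucc_prod_of_cmHodgeHypothesis hCM hC (max a b))

/-! ### The two displayed sub-classes: maximal real multiplication by a totally real field, and non-CM elliptic curves -/

/-- **HC_CM ⟹ HC(`A^{M+1} × C^{N+1}`) for `A` with `End⁰(A)` a totally real field of degree `dim A` and `C` of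
CM type** (Ribet 1983 Thm. 0 / Hazama 1983 on the `A`-side, `hasRealSl2Blocks_of_isTotallyReal`).
[cite: Lombardo2016, Lemma 3.4 (p. 1229)] [cite: Ribet1983, Thm. 0–1] [cite: Milne1999, §7 p. 72] -/
theorem hodgeConjectureFor_powSucc_prod_powSucc_of_isTotallyReal_of_cmType_of_cmHodgeHypothesis
    (hCM : ∀ Y : AbelianVariety ℂ, Milne1999.CMHodgeHypothesisAt Y) (A : AbelianVariety ℂ)
    (hF : IsField A.endAlgebra) [IsTotallyReal (EndField A hF)] (hdeg : Module.finrank ℚ A.endAlgebra = A.dim)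
    (hC : Milne1999.IsOfCMType C) (M N : ℕ) :
    HodgeConjectureFor ((A.powSucc M).prod (C.powSucc N)).dim ((A.powSucc M).prod (C.powSucc N)).X :=
  (hasRealSl2Blocks_of_isTotallyReal A hF hdeg).hodgeConjectureFor_powSucc_prod_powSucc_of_cmHodgeHypothesis'
    hCM hC M N

/-- **HC_CM ⟹ HC(`E^{M+1} × C^{N+1}`) for `E` an elliptic curve without complex multiplication (`End⁰(E) = ℚ`)
and `C` of CM type of any dimension.** [cite: Lombardo2016, Lemma 3.4 (p. 1229)] [cite: Milne1999, §7 p. 72] -/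
theorem hodgeConjectureFor_powSucc_prod_powSucc_of_finrank_endAlgebra_eq_one_of_cmType_of_cmHodgeHypothesis
    (hCM : ∀ Y : AbelianVariety ℂ, Milne1999.CMHodgeHypothesisAt Y) (E : AbelianVariety ℂ)
    (h1 : Module.finrank ℚ E.endAlgebra = 1) (hdim : E.dim = 1) (hC : Milne1999.IsOfCMType C) (M N : ℕ) :
    HodgeConjectureFor ((E.powSucc M).prod (C.powSucc N)).dim ((E.powSucc M).prod (C.powSucc N)).X :=
  (hasRealSl2Blocks_of_finrank_endAlgebra_eq_one E h1 hdim).hodgeConjectureFor_powSucc_prod_powSucc_of_cmHodgeHypothesis'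
    hCM hC M N

end ProductSpan

end Literature.AlgebraicGeometry.HodgeTheory

end
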